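import Summits.Ventures.Crystal3D.Bulk.GapThreeConnected
import Summits.Ventures.Crystal3D.Bulk.GapFaceMeet
import Summits.Ventures.Crystal3D.Bulk.GapFaceSides
import Summits.Ventures.Crystal3D.Bulk.GapFaceSizes
import Summits.Ventures.Crystal3D.Bulk.GapFaceHemisphere
import Summits.Ventures.Crystal3D.Bulk.GapTightConnected
import HarnessLib

/-!
# The ENUMERATION PREMISES of the GAP census, packaged: every census configuration's tight map
# lies in the plane-map class the census enumerates (`plantri -p -c3 -m3 -f6`, marked hole of
# degree `≤ 4`), as ONE kernel theorem on `CensusRows`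

HONEST FRAMING. Part of the venture `Summits/Ventures/Crystal3D` (cell `pub-crystal3d`, phase 2;
seat typer-bulk-2). Bookkeeping file, nothing new geometrically: the structure `PlaneMapClass c`
lists, as fields, the combinatorial invariants of the oriented tight map
(`darts c`, rotation `onextNbr`, faces `ofaces c` = the `φ°`-orbits) that define the universe of
the enumeration (the cell's `DECISION-ENGINE3-ROWS.md` §2 «ENUMERATION PREMISES ↔ KERNEL»,
lead RULINGs #114/#116/#140) — Euler's relation (genus `0`), connected / no cut vertex / no
separating pair (`-c3`), degrees `3 … 5` and hole degree `≤ 4` below `58.28°` (`-m3`, `deg p ≤ 4`),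
faces simple strictly convex polygons in open hemispheres with `3 … 6` sides and `≤ 5` sides off the
hole (`-f6`), the two sides of every edge distinct, two faces meeting in ∅ / a vertex / an edge,
and L3 — and **`CensusRows.planeMapClass`** discharges ALL of them from the tree
(`Bulk/GapTightConnected`, `GapTwoConnected`, `GapThreeConnected`, `GapActiveFaces`,
`GapFaceSizes`, `GapFaceHemisphere`, `GapFaceSides`, `GapFaceMeet`, `GapActiveHemisphere`, the
degree rows of `CensusRows`). What is NOT a kernel statement: that the generator (plantri 5.5 /
engine-5's) lists every rooted oriented plane map with these invariants (generator completeness,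
Brinkmann–McKay), and the rattler-hosting rows (d1)–(d3) of the `r ≥ 1` strata. Nothing is claimed
about GAP(1.26).
-/

noncomputable section

open scoped InnerProductSpace

namespace Summit.Ventures.Crystal3D

open Literature.Geometry.DiscreteGeometry Finset Function

variable {c : Fin 14 → EuclideanSpace ℝ (Fin 3)}

/-- **The plane-map class of the census.** The combinatorial invariants of the oriented tight map
of a fourteen-ball configuration `c` (vertices `activeVertices c`, darts `darts c`, rotation
`onextNbr c`, faces `ofaces c`) under which the census enumerates it: plantri's class
`-p -c3 -m3 -f6` on `#activeVertices c` vertices with the hole `13` marked, `deg ≤ 5`,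
`deg 13 ≤ 4` below hole radius `58.28°`, `x`-faces `≤ 5`, plus the geometric shape clauses the
per-cell instruments read (faces strictly convex, in open hemispheres; L3). -/
structure PlaneMapClass (c : Fin 14 → EuclideanSpace ℝ (Fin 3)) : Prop where
  /-- the hole is a vertex of the map -/
  hole_mem : (13 : Fin 14) ∈ activeVertices c
  /-- the face successor `φ°` permutes the darts (faces = its orbits) -/
  ofaceSucc_bijOn : Set.BijOn (ofaceSucc c) (darts c : Set (Fin 14 × Fin 14)) (darts c)
  /-- Euler's relation `V − E + F = 2`: a connected plane map (genus `0`) -/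
  euler : ((activeVertices c).card : ℤ) - tightCount c + onumFaces c = 2
  /-- connected (closure form) -/
  connected : TightConnected c
  /-- no cut vertex -/
  twoConnected : ∀ v ∈ activeVertices c, ∀ A : Finset (Fin 14), A ⊆ (activeVertices c).erase v →
    A.Nonempty → (∀ i ∈ A, ∀ j : Fin 14, (i, j) ∈ darts c → j ≠ v → j ∈ A) →
    A = (activeVertices c).erase v
  /-- no separating pair (`-c3`) -/
  threeConnected : ∀ u ∈ activeVertices c, ∀ v ∈ activeVertices c, u ≠ v →
    ∀ A : Finset (Fin 14), A ⊆ ((activeVertices c).erase u).erase v → A.Nonempty →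
    (∀ i ∈ A, ∀ j : Fin 14, (i, j) ∈ darts c → j ≠ u → j ≠ v → j ∈ A) →
    A = ((activeVertices c).erase u).erase v
  /-- minimum degree `3` (`-m3`) -/
  three_le_degree : ∀ v ∈ activeVertices c, 3 ≤ (tightNbrs c v).card
  /-- maximum degree `5` -/
  degree_le_five : ∀ v ∈ activeVertices c, (tightNbrs c v).card ≤ 5
  /-- the hole has degree `≤ 4` once `1.0515 ≤ D` (hole radius `≤ 58.28°`) -/
  degree_hole_le_four : (1.0515 : ℝ) ≤ intruderDist c → (tightNbrs c 13).card ≤ 4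
  /-- every face has `≥ 3` darts -/
  three_le_ofaceLen : ∀ q ∈ darts c, 3 ≤ ofaceLen c q
  /-- every face has `≤ 6` darts (`-f6`) -/
  ofaceLen_le_six : ∀ q ∈ darts c, ofaceLen c q ≤ 6
  /-- a face avoiding the hole has `≤ 5` darts -/
  ofaceLen_le_five : ∀ q ∈ darts c, (∀ t, t < ofaceLen c q → ((ofaceSucc c)^[t] q).1 ≠ 13) →
    ofaceLen c q ≤ 5
  /-- faces are simple: the vertices of a face walk are pairwise distinct -/
  face_simple : ∀ q ∈ darts c, ∀ i j : ℕ, i < j → j < ofaceLen c q →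
    ((ofaceSucc c)^[i] q).1 ≠ ((ofaceSucc c)^[j] q).1
  /-- LEMMA L: faces are strictly convex spherical polygons (clockwise walks) -/
  face_convex : ∀ q ∈ darts c, ∀ i j k : ℕ, i < j → j < k → k < ofaceLen c q →
    orient3 (gapDir c ((ofaceSucc c)^[i] q).1) (gapDir c ((ofaceSucc c)^[j] q).1)
      (gapDir c ((ofaceSucc c)^[k] q).1) < 0
  /-- every face lies in an open hemisphere -/
  face_hemisphere : ∀ q ∈ darts c, ∃ z : EuclideanSpace ℝ (Fin 3), ∀ t, t < ofaceLen c q →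
    ⟪z, gapDir c ((ofaceSucc c)^[t] q).1⟫_ℝ < 0
  /-- the two sides of every edge are distinct faces -/
  swap_side_ne : ∀ q ∈ darts c, ofaceOf c q.swap ≠ ofaceOf c q
  /-- two distinct faces with two common vertices are the two sides of the edge joining them -/
  faces_meet : ∀ F ∈ ofaces c, ∀ G ∈ ofaces c, F ≠ G → ∀ x y : Fin 14, x ≠ y →
    x ∈ F.image Prod.fst → x ∈ G.image Prod.fst → y ∈ F.image Prod.fst → y ∈ G.image Prod.fst →
    ((x, y) ∈ F ∧ (y, x) ∈ G) ∨ ((y, x) ∈ F ∧ (x, y) ∈ G)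
  /-- two distinct faces have at most two common vertices -/
  card_common_vertices_le_two : ∀ F ∈ ofaces c, ∀ G ∈ ofaces c, F ≠ G →
    (F.image Prod.fst ∩ G.image Prod.fst).card ≤ 2
  /-- L3: the vertices lie in no closed hemisphere -/
  no_closed_hemisphere : ∀ v : EuclideanSpace ℝ (Fin 3), v ≠ 0 →
    ∃ i ∈ activeVertices c, ⟪v, gapDir c i⟫_ℝ < 0

/-- **Every census configuration's tight map lies in the plane-map class of the census.** -/
theorem CensusRows.planeMapClass (h : CensusRows c) : PlaneMapClass c := by
  obtain ⟨hD3, -, hD2⟩ := h.intruderDist_bounds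
  have hdeg : ∀ v ∈ activeVertices c, 3 ≤ (tightNbrs c v).card ∧ (tightNbrs c v).card ≤ 5 := by
    intro v hv
    obtain ⟨hv0, hne⟩ := mem_activeVertices.1 hv
    have hset : (univ.filter fun j : Fin 14 => j ≠ 0 ∧ j ≠ v ∧ dist (c v) (c j) = 1) =
        tightNbrs c v := rfl
    by_cases hv13 : v = 13
    · subst hv13
      have h3 := h.three_le_card_intruderContacts
      have h5 := h.card_intruderContacts_le_five
      rw [hset] at h3 h5
      exact ⟨h3, h5⟩
    · obtain ⟨j, hj⟩ := hne
      have h3 := h.three_le_card_tight v hv0 hv13 ⟨j, mem_tightNbrs.1 hj⟩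
      have h5 := h.card_tight_le_five v hv0 hv13
      rw [hset] at h3 h5
      exact ⟨h3, h5⟩
  refine
    { hole_mem := h.thirteen_mem_activeVertices
      ofaceSucc_bijOn := h.isGapConfig.ofaceSucc_bijOn hD3
      euler := h.oriented_euler
      connected := h.tightConnected
      twoConnected := fun v hv A hA hAne hAcl => h.tightTwoConnected hv hA hAne hAcl
      threeConnected := fun u hu v hv huv A hA hAne hAcl =>
        h.tightThreeConnected hu hv huv hA hAne hAcl
      three_le_degree := fun v hv => (hdeg v hv).1
      degree_le_five := fun v hv => (hdeg v hv).2
      degree_hole_le_four := fun hlo => ?_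
      three_le_ofaceLen := fun q hq => h.three_le_ofaceLen hq
      ofaceLen_le_six := fun q hq => h.ofaceLen_le_six hq
      ofaceLen_le_five := fun q hq hx => h.ofaceLen_le_five_of_forall_ne hq hx
      face_simple := fun q hq i j hij hj => h.fst_iterate_ofaceSucc_injOn hq hij hj
      face_convex := fun q hq i j k hij hjk hk => h.orient3_oface_neg hq hij hjk hk
      face_hemisphere := fun q hq => h.exists_inner_neg_oface hq
      swap_side_ne := fun q hq => h.ofaceOf_swap_ne hq
      faces_meet := fun F hF G hG hFG x y hxy hxF hxG hyF hyG =>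
        h.ofaces_meet hF hG hFG hxy hxF hxG hyF hyG
      card_common_vertices_le_two := fun F hF G hG hFG => h.card_common_vertices_le_two hF hG hFG
      no_closed_hemisphere := fun v hv => h.exists_active_inner_neg hv }
  have h4 := h.card_intruderContacts_le_four hlo
  have hset : (univ.filter fun j : Fin 14 => j ≠ 0 ∧ j ≠ 13 ∧ dist (c 13) (c j) = 1) =
      tightNbrs c 13 := rfl
  rw [hset] at h4
  exact h4

end Summit.Ventures.Crystal3D
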